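import Literature.AlgebraicGeometry.HodgeTheory.CMFieldHodgeGroupPowersHodgeClasses
import Literature.AlgebraicGeometry.HodgeTheory.CMHodgeGroupOneScalarPlace
import Literature.AlgebraicGeometry.Motives.ComplexTorusSimpleTransfer
import HarnessLib

/-!
# `Hg(A) = U_F` (Lie form) for a SIMPLE complex abelian variety with `End⁰(A) = F` a CM field of degree `2|ι| ≤ 6` acting
# with multiplicity `2` and ONE `Θ`-scalar place — e.g. simple abelian sixfolds with `End⁰` a sextic CM field of CM pattern
# `(n_σ) = (2,1,1)` (Moonen–Zarhin 1999 §2 (2.3); Ribet 1983 Thm. 0)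

Family `hodge`, layer `Literature/AlgebraicGeometry/HodgeTheory` (brick P5, GEOMETRIC half, of the design note
`HOME/jobs/A7-inventory-eng5g6/DESIGN-rows10-12-allmembers.md` of the cell `pub-hodgeav-hg6`, req-37 (A) Q2b, TABLE X row 12
ALL MEMBERS of pattern `(2,1,1)`). UNCONDITIONAL for the class of abelian varieties it names; theorems only, no definition, no
named fact, no `sorry`. HONEST FRAMING of that cell: HC / HC_AV / HC_CM / H2 NOT proved — what is proved is the hypothesis
`hU` («`Lie Hg(H¹(A)) ⊗ ℂ ⊇ 𝔲_F ⊗ ℂ`») of the cell's census row `census_row12_sexticGeneral` for these members.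

* **`AbelianVariety.hodgeLieC_of_cmField_oneScalarPlace`** — for `A` simple with `finrank_ℚ End⁰(A) = 2|ι|`, `|ι| ≤ 3`,
  `φ ∈ End(A)` with colours `μ : ι → ℂ` (injective, none conjugate to another or itself),
  `eigenMultiplicity A φ (μ k) + eigenMultiplicity A φ (conj μ k) = 2` for every `k`, `dim A = 2|ι|`, ONE place `k₀` with
  `eigenMultiplicity A φ (μ k₀) = 0` or `eigenMultiplicity A φ (conj μ k₀) = 0` and all other places balanced (both
  multiplicities non-zero, i.e. `= 1`), and a polarization `ψ` of `H¹(A(ℂ); ℚ)`: every `(φ^*)_ℂ`-commuting `ψ_ℂ`-skew operator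
  of `H¹(A(ℂ); ℂ)` lies in `Lie Hg(H¹(A)) ⊗ ℂ`. The Hodge-theoretic core is `CMThetaOneScalar.mem_hodgeLieC_of_commute_of_skew`;
  this file supplies the dictionary (`exists_eq_sum_smul_pow_bettiMapHom_fin`, the multiplicity dictionary, Riemann's
  `End⁰(A)ᵐᵒᵖ ≃ End_Hdg(H¹)` and Mumford's «simple ⟹ `End⁰` is a division ring»).

## References
* [MoonenZarhin1999LowDim] B. Moonen, Yu. Zarhin, Math. Ann. 315 (1999), §2 (2.3), (1.8).
* [Ribet1983] K. A. Ribet, Amer. J. Math. 105 (1983), Thm. 0.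
* [MumfordAV1970] D. Mumford, Abelian Varieties (1970), §19 Cor. 2 of Thm. 1 (p. 174).
* [DeligneMilne1982Tannakian] P. Deligne, J. Milne, LNM 900 (1982), §6 Thm. 6.20.
-/

noncomputable section

open scoped TensorProduct Matrix
open CategoryTheory Module

namespace Literature.AlgebraicGeometry.HodgeTheory

open Literature.AlgebraicTopology.SingularHomology
open Literature.AlgebraicGeometry.Motives (IsSmoothProjective AbelianVariety bettiCohomology HodgeTensorFacts
  hodgeTensorFacts_holds)
open Literature.AlgebraicGeometry.Motives.HodgeStructure
open Literature.AlgebraicGeometry.ComplexMultiplication (bettiRep bettiRep_of)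

variable {ι : Type} [Fintype ι] [DecidableEq ι]

/-- The two elements of `Fin 2`. [folklore] -/
private theorem fin2_cases'''' (r : Fin 2) : r = 0 ∨ r = 1 := by
  fin_cases r <;> simp

/-- **`Lie Hg(H¹(A)) ⊗ ℂ ⊇ 𝔲_F ⊗ ℂ` FOR A SIMPLE ABELIAN VARIETY WITH `End⁰(A) = F` A CM FIELD OF DEGREE `2|ι| ≤ 6`,
MULTIPLICITY `2`, ONE `Θ`-SCALAR PLACE** (see the module docstring). [cite: MoonenZarhin1999LowDim, §2 (2.3)]
[cite: Ribet1983, Thm. 0] [cite: MumfordAV1970, §19 Cor. 2 of Thm. 1 (p. 174)] [cite: DeligneMilne1982Tannakian, §6 Thm. 6.20] -/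
theorem AbelianVariety.hodgeLieC_of_cmField_oneScalarPlace [HodgeTensorFacts.{0, 0}] (hι : Fintype.card ι ≤ 3)
    (A : AbelianVariety ℂ) (hAs : A.IsSimple) (φ : A ⟶ A)
    (hE : Module.finrank ℚ A.endAlgebra = 2 * Fintype.card ι) (μ : ι → ℂ) (hinj : Function.Injective μ)
    (hdist : ∀ k k', μ k' ≠ starRingEnd ℂ (μ k))
    (hmult : ∀ k, eigenMultiplicity A φ (μ k) + eigenMultiplicity A φ (starRingEnd ℂ (μ k)) = 2)
    (hdim : A.dim = Fintype.card ι * 2) (k₀ : ι)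
    (hk₀ : eigenMultiplicity A φ (μ k₀) = 0 ∨ eigenMultiplicity A φ (starRingEnd ℂ (μ k₀)) = 0)
    (hbal : ∀ k, k ≠ k₀ → eigenMultiplicity A φ (μ k) ≠ 0 ∧ eigenMultiplicity A φ (starRingEnd ℂ (μ k)) ≠ 0)
    (hHD : exists_isReal_hodgeModel) (hI : hodgePQ_independent_of_hodgeModel)
    (ψ : (BettiUniverse.hodge hHD (AbelianVariety.isSmoothProjective_holds (A := A)) 1).Polarization) :
    ∀ Y : Module.End ℂ (ℂ ⊗[ℚ] bettiCohomology A.X 1),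
      Y * ((bettiCohomology.map φ.hom.hom.hom 1).hom).baseChange ℂ =
          ((bettiCohomology.map φ.hom.hom.hom 1).hom).baseChange ℂ * Y →
        (∀ x y, ψ.form.baseChange ℂ (Y x) y + ψ.form.baseChange ℂ x (Y y) = 0) →
          Y ∈ (BettiUniverse.hodge hHD (AbelianVariety.isSmoothProjective_holds (A := A)) 1).hodgeLieC := by
  classical
  intro Y hYφ hYskew
  haveI : Module.Finite ℚ (bettiCohomology A.X 1) := finite_bettiCohomology_one A
  have hX : IsSmoothProjective A.dim A.X := AbelianVariety.isSmoothProjective_holds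
  have heff := BettiUniverse.hodge_isEffective hHD hX 1
  -- the rational datum `φ^*_ℚ`
  set φQ : Module.End ℚ (bettiCohomology A.X 1) := (bettiCohomology.map φ.hom.hom.hom 1).hom with hφQ
  have hφE : φQ ∈ (BettiUniverse.hodge hHD (AbelianVariety.isSmoothProjective_holds (A := A)) 1).endAlg := by
    have h := unop_bettiRep_mem_endAlg hHD hI (AbelianVariety.endAlgebra.of A φ)
    rwa [bettiRep_of, MulOpposite.unop_op] at h
  have hVC : Module.finrank ℂ (ℂ ⊗[ℚ] bettiCohomology A.X 1) = Fintype.card (ι × Fin 2) * 2 := by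
    rw [Module.finrank_baseChange, finrank_bettiCohomology_one A, hdim, Fintype.card_prod, Fintype.card_fin]; ring
  -- the `2|ι|` eigenvalues, pairwise distinct
  set ev : ι × Fin 2 → ℂ := fun kt => if kt.2 = 0 then μ kt.1 else starRingEnd ℂ (μ kt.1) with hevdef
  have hev0 : ∀ k, ev (k, 0) = μ k := fun k => by simp [hevdef]
  have hev1 : ∀ k, ev (k, 1) = starRingEnd ℂ (μ k) := fun k => by simp [hevdef]
  have hev : Function.Injective ev := by
    rintro ⟨k, t⟩ ⟨k', t'⟩ h
    rcases fin2_cases'''' t with rfl | rfl <;> rcases fin2_cases'''' t' with rfl | rfl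
    · rw [hev0, hev0] at h; rw [hinj h]
    · rw [hev0, hev1] at h; exact absurd h (hdist k' k)
    · rw [hev1, hev0] at h; exact absurd h.symm (hdist k k')
    · rw [hev1, hev1] at h; rw [hinj ((starRingEnd ℂ).injective h)]
  -- the multiplicity dictionary
  have hgr := fun cc => CMTheta.finrank_eigenspace_eq_add (BettiUniverse.hodge hHD (AbelianVariety.isSmoothProjective_holds (A := A)) 1) Nat.cast_one heff hφE cc
  have h10 : ∀ cc, Module.finrank ℂ ↥(Module.End.eigenspace (φQ.baseChange ℂ) cc ⊓ (BettiUniverse.hodge hHD (AbelianVariety.isSmoothProjective_holds (A := A)) 1).piece 1 0) =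
      eigenMultiplicity A φ cc := fun cc => by
    rw [hφQ, finrank_eigenspace_inf_piece_oneZero_eq_eigenMultiplicity hHD hI φ cc]
  have h01 : ∀ cc, Module.finrank ℂ ↥(Module.End.eigenspace (φQ.baseChange ℂ) cc ⊓ (BettiUniverse.hodge hHD (AbelianVariety.isSmoothProjective_holds (A := A)) 1).piece 0 1) =
      eigenMultiplicity A φ (starRingEnd ℂ cc) := fun cc => by
    rw [hφQ, finrank_eigenspace_inf_piece_zeroOne_eq_eigenMultiplicity_conj hHD hI φ cc]
  have hfin : ∀ kt, Module.finrank ℂ ↥(Module.End.eigenspace (φQ.baseChange ℂ) (ev kt)) = 2 := by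
    rintro ⟨k, t⟩
    rw [hgr, h10, h01]
    rcases fin2_cases'''' t with rfl | rfl
    · rw [hev0]; exact hmult k
    · rw [hev1, starRingEnd_self_apply, add_comm]; exact hmult k
  have hW : ∀ kt, Module.End.eigenspace (φQ.baseChange ℂ) (ev kt) ≠ ⊥ := by
    intro kt hkt
    have h := hfin kt
    rw [hkt, finrank_bot] at h
    omega
  -- `End_Hdg = ℚ[φQ]`
  have hcard : Fintype.card (ι × Fin 2) = 2 * Fintype.card ι := by rw [Fintype.card_prod, Fintype.card_fin, mul_comm]
  set e : ι × Fin 2 ≃ Fin (2 * Fintype.card ι) := Fintype.equivFinOfCardEq hcard with hedef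
  have hEφ := exists_eq_sum_smul_pow_bettiMapHom_fin hHD hI φ hE (ev ∘ e.symm) (hev.comp e.symm.injective)
    fun j => hW (e.symm j)
  -- `hrank`, `htop`
  have hrank : ∀ k, Module.finrank ℂ ↥(Module.End.eigenspace (φQ.baseChange ℂ) (μ k) ⊓ (BettiUniverse.hodge hHD (AbelianVariety.isSmoothProjective_holds (A := A)) 1).piece 1 0) +
      Module.finrank ℂ ↥(Module.End.eigenspace (φQ.baseChange ℂ) (μ k) ⊓ (BettiUniverse.hodge hHD (AbelianVariety.isSmoothProjective_holds (A := A)) 1).piece 0 1) = 2 := fun k => by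
    rw [h10, h01]; exact hmult k
  have htop : (⨆ kt : ι × Fin 2, Module.End.eigenspace (φQ.baseChange ℂ) (ev kt)) = ⊤ := by
    have hind : iSupIndep fun kt => Module.End.eigenspace (φQ.baseChange ℂ) (ev kt) :=
      (Module.End.eigenspaces_iSupIndep (φQ.baseChange ℂ)).comp hev
    apply Submodule.eq_top_of_finrank_eq
    have h := Motives.finrank_biSup_eq_sum_of_iSupIndep hind Finset.univ
    have hs : (⨆ kt ∈ (Finset.univ : Finset (ι × Fin 2)), Module.End.eigenspace (φQ.baseChange ℂ) (ev kt)) =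
        ⨆ kt, Module.End.eigenspace (φQ.baseChange ℂ) (ev kt) := by simp
    rw [hs] at h
    rw [h, hVC, Finset.sum_congr rfl fun kt _ => hfin kt, Finset.sum_const, Finset.card_univ, smul_eq_mul]
  -- `dim_ℚ End_Hdg = 2|ι|` and the division property (`A` simple)
  have hEdim : Module.finrank ℚ (BettiUniverse.hodge hHD (AbelianVariety.isSmoothProjective_holds (A := A)) 1).endAlg = 2 * Fintype.card ι := by
    rw [finrank_endAlg_hodge_one hHD hI, hE]
  have hdiv : ∀ a ∈ (BettiUniverse.hodge hHD (AbelianVariety.isSmoothProjective_holds (A := A)) 1).endAlg, a ≠ 0 →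
      ∃ b : Module.End ℚ (bettiCohomology A.X 1), b * a = 1 := by
    intro a ha ha0
    set x := (endAlgebraOpAlgEquivEndAlg (B := A) hHD hI).symm ⟨a, ha⟩ with hxdef
    have hx : ((endAlgebraOpAlgEquivEndAlg (B := A) hHD hI x : (BettiUniverse.hodge hHD (AbelianVariety.isSmoothProjective_holds (A := A)) 1).endAlg) :
        Module.End ℚ (bettiCohomology A.X 1)) = a := by
      rw [hxdef, AlgEquiv.apply_symm_apply]
    have hx0 : MulOpposite.unop x ≠ 0 := by
      intro h0
      have : x = 0 := MulOpposite.unop_injective (by rw [h0, MulOpposite.unop_zero])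
      apply ha0
      rw [← hx, this, map_zero]
      rfl
    obtain ⟨y, hxy, -⟩ :=
      Literature.AlgebraicGeometry.ComplexMultiplication.endAlgebra_exists_inv_of_isSimple hAs (MulOpposite.unop x) hx0
    refine ⟨((endAlgebraOpAlgEquivEndAlg (B := A) hHD hI (MulOpposite.op y) : (BettiUniverse.hodge hHD (AbelianVariety.isSmoothProjective_holds (A := A)) 1).endAlg) :
      Module.End ℚ (bettiCohomology A.X 1)), ?_⟩
    rw [← hx, ← Subalgebra.coe_mul, ← map_mul, ← MulOpposite.op_unop x, ← MulOpposite.op_mul, hxy,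
      MulOpposite.op_one, map_one, Subalgebra.coe_one]
  -- the pattern, in the Hodge dictionary
  have hk₀' : Module.finrank ℂ ↥(Module.End.eigenspace (φQ.baseChange ℂ) (μ k₀) ⊓ (BettiUniverse.hodge hHD (AbelianVariety.isSmoothProjective_holds (A := A)) 1).piece 1 0) = 0 ∨
      Module.finrank ℂ ↥(Module.End.eigenspace (φQ.baseChange ℂ) (μ k₀) ⊓ (BettiUniverse.hodge hHD (AbelianVariety.isSmoothProjective_holds (A := A)) 1).piece 0 1) = 0 := by
    rw [h10, h01]; exact hk₀
  have hbal' : ∀ k, k ≠ k₀ → Module.finrank ℂ ↥(Module.End.eigenspace (φQ.baseChange ℂ) (μ k) ⊓ (BettiUniverse.hodge hHD (AbelianVariety.isSmoothProjective_holds (A := A)) 1).piece 1 0) ≠ 0 ∧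
      Module.finrank ℂ ↥(Module.End.eigenspace (φQ.baseChange ℂ) (μ k) ⊓ (BettiUniverse.hodge hHD (AbelianVariety.isSmoothProjective_holds (A := A)) 1).piece 0 1) ≠ 0 := fun k hk => by
    rw [h10, h01]; exact hbal k hk
  exact CMThetaOneScalar.mem_hodgeLieC_of_commute_of_skew hι (BettiUniverse.hodge hHD (AbelianVariety.isSmoothProjective_holds (A := A)) 1) Nat.cast_one heff ψ hφE hEφ
    hEdim hdiv μ hinj hdist hrank htop k₀ hk₀' hbal' hYφ hYskew

end Literature.AlgebraicGeometry.HodgeTheory
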